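import Summits.ResolutionOfSingularities.ResolutionOfSingularities.Theorems.EquisingularLiftEquisingularLiftOfBlowupModels
import Summits.ResolutionOfSingularities.ResolutionOfSingularities.Theorems.EquisingularLiftEquisingularLiftCJS2020SequenceOfSigmaMax
import Summits.ResolutionOfSingularities.ResolutionOfSingularities.Theorems.EquisingularLiftEquisingularLiftBlowupModelFourOfCP2008
import HarnessLib

/-!
# Crux `EquisingularLift` (stmt-ResolutionOfSingularities-15660), line `Sketch` (skeleton v10c `f3e6993bf39ec5c9`):
# the line's conditional assembly with its debt REDUCED — `EquisingularLift` from ONE CJS trunk fact, ONE Cossart–Piltant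
# theorem and the open residual in dimension `≥ 4`

[OURS · leafhand-res-equisingularlift-1 g1, 2026-08-31] AI-produced, weaker than expert review; NOT a statement of any
manuscript; nothing here proves resolution of singularities in positive characteristic.

The tree's assembly `EquisingularLift_of_CJS_CP_of_blowupModels_ge_five` (file `…OfBlowupModels`) derives the crux from FOUR
inputs: `CossartJannsenSaito2020Sequence`, `CossartPiltant2019General`, `CossartPiltant2019Principalization` and the open
residual `h5` (regular blow-up models of integral hypersurfaces of `ℙⁿ_k̄`, `n ≥ 5` = resolution in dimension `≥ 4` over
algebraically closed fields).  With the sibling files `…CJS2020SequenceOfSigmaMax` (p798090) and `…BlowupModelFourOfCP2008`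
the same crux follows from THREE inputs, two of them single trunk facts of the tree's ports:

* `EquisingularLift_of_sigmaMaxElimination_CP2008_of_blowupModels_ge_five` — from `CossartJannsenSaito2020_sigmaMaxElimination`
  (CJS Thm. 6.28 + 3.10 (1): `Σ^max`-eliminations in dimension `≤ 2`; = the `SigmaMaxModifications` crux stub),
  `CP2008.ResolutionQuasiProjectiveThreefolds` (Cossart–Piltant 2008 Thm. 2.1 / 2009 "Theorem", verbatim) and `h5`;
* `EquisingularLift_of_nuElimination_CP2008_of_blowupModels_ge_five` — the same with the `ν`-wise CJS Thm. 6.28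
  (`CossartJannsenSaito2020_nuElimination`);
* `EquisingularLift_of_sigmaMaxElimination_CP2019General_of_blowupModels_ge_five` — with Cossart–Piltant 2019 Thm. 1.1 (i)(ii)
  (`CossartPiltant2019General`) in place of the 2008 theorem (Prop. 4.4 no longer an input: discharged in the tree).

Honest label: CONDITIONAL results; the third input `h5` is the summit itself over `k̄` in dimension `≥ 4` (barrier
`DimensionFourFrontier`), so none of these closes the item.

References: [CossartJannsenSaito2020, Thm. 6.28, Cor. 6.18]; [CossartPiltant2008, Thm. 2.1]; [CossartPiltant2009, Theorem
p. 1839]; [CossartPiltant2019, Thm. 1.1, Prop. 4.4].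
-/

set_option linter.dupNamespace false -- mandated namespace `Summit.<Summit>.<Problem>` of this single-conjunct summit

noncomputable section

open CategoryTheory AlgebraicGeometry
open Literature.AlgebraicGeometry.Resolution Literature.AlgebraicGeometry.CossartPiltant200819

namespace Summit.ResolutionOfSingularities.ResolutionOfSingularities.Cruxes.EquisingularLift.StrataSplit

/-- **`EquisingularLift` from CJS `Σ^max`-eliminations in dimension `≤ 2`, Cossart–Piltant 2008/2009 for threefolds, and the
open residual in dimension `≥ 4`** (CONDITIONAL; the linear-centre lift `equisingularLift_of_blowupModels` over the dimension
split `blowupModel_ge_three_of_cases`). [cite: CossartJannsenSaito2020, Thm. 6.28, Cor. 6.18] [cite: CossartPiltant2008, Thm. 2.1] -/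
theorem EquisingularLift_of_sigmaMaxElimination_CP2008_of_blowupModels_ge_five
    (hσ : CossartJannsenSaito2020_sigmaMaxElimination.{0}) (h2008 : CP2008.ResolutionQuasiProjectiveThreefolds.{0})
    (h5 : ∀ p : ℕ, p.Prime → ∀ (k : Type) [Field k] [CharP k p] [IsAlgClosed k] (n : ℕ) (H : AlgebraicGeometry.Scheme.{0}) (ι : H ⟶ (Literature.AlgebraicGeometry.Motives.projectiveSpace n k).left), AlgebraicGeometry.IsClosedImmersion ι → AlgebraicGeometry.IsIntegral H → (∀ y : (Literature.AlgebraicGeometry.Motives.projectiveSpace n k).left, ∃ U : (Literature.AlgebraicGeometry.Motives.projectiveSpace n k).left.affineOpens, y ∈ (U : (Literature.AlgebraicGeometry.Motives.projectiveSpace n k).left.Opens) ∧ (ι.ker.ideal U).IsPrincipal) → 5 ≤ n → ∃ 𝔞 : H.IdealSheafData, 𝔞 ≠ ⊥ ∧ ∀ (Z : AlgebraicGeometry.Scheme.{0}) (π : Z ⟶ H), Literature.AlgebraicGeometry.Resolution.IsBlowup π 𝔞 → Literature.AlgebraicGeometry.Resolution.Scheme.IsRegular Z) :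
    Summit.ResolutionOfSingularities.ResolutionOfSingularities.Theses.EquisingularLift.EquisingularLift :=
  equisingularLift_of_blowupModels (blowupModel_ge_three_of_cases (stub_blowupModel_three_of_sigmaMaxElimination hσ)
    (stub_blowupModel_four_of_CP2008 h2008) h5)

/-- **`EquisingularLift` from the `ν`-wise CJS Thm. 6.28, Cossart–Piltant 2008/2009 and the open residual in dimension `≥ 4`**
(CONDITIONAL). [cite: CossartJannsenSaito2020, Thm. 6.28, Def. 6.14] [cite: CossartPiltant2008, Thm. 2.1] -/
theorem EquisingularLift_of_nuElimination_CP2008_of_blowupModels_ge_five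
    (hν : CossartJannsenSaito2020_nuElimination.{0}) (h2008 : CP2008.ResolutionQuasiProjectiveThreefolds.{0})
    (h5 : ∀ p : ℕ, p.Prime → ∀ (k : Type) [Field k] [CharP k p] [IsAlgClosed k] (n : ℕ) (H : AlgebraicGeometry.Scheme.{0}) (ι : H ⟶ (Literature.AlgebraicGeometry.Motives.projectiveSpace n k).left), AlgebraicGeometry.IsClosedImmersion ι → AlgebraicGeometry.IsIntegral H → (∀ y : (Literature.AlgebraicGeometry.Motives.projectiveSpace n k).left, ∃ U : (Literature.AlgebraicGeometry.Motives.projectiveSpace n k).left.affineOpens, y ∈ (U : (Literature.AlgebraicGeometry.Motives.projectiveSpace n k).left.Opens) ∧ (ι.ker.ideal U).IsPrincipal) → 5 ≤ n → ∃ 𝔞 : H.IdealSheafData, 𝔞 ≠ ⊥ ∧ ∀ (Z : AlgebraicGeometry.Scheme.{0}) (π : Z ⟶ H), Literature.AlgebraicGeometry.Resolution.IsBlowup π 𝔞 → Literature.AlgebraicGeometry.Resolution.Scheme.IsRegular Z) :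
    Summit.ResolutionOfSingularities.ResolutionOfSingularities.Theses.EquisingularLift.EquisingularLift :=
  EquisingularLift_of_sigmaMaxElimination_CP2008_of_blowupModels_ge_five
    (CossartJannsenSaito2020_sigmaMaxElimination_of_nuElimination hν) h2008 h5

/-- **`EquisingularLift` from CJS `Σ^max`-eliminations in dimension `≤ 2`, Cossart–Piltant 2019 Thm. 1.1 (i)(ii) and the open
residual in dimension `≥ 4`** (CONDITIONAL; Prop. 4.4 folded in through its discharge).
[cite: CossartJannsenSaito2020, Thm. 6.28, Cor. 6.18] [cite: CossartPiltant2019, Thm. 1.1, Prop. 4.4] -/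
theorem EquisingularLift_of_sigmaMaxElimination_CP2019General_of_blowupModels_ge_five
    (hσ : CossartJannsenSaito2020_sigmaMaxElimination.{0}) (hCP : CossartPiltant2019General.{0})
    (h5 : ∀ p : ℕ, p.Prime → ∀ (k : Type) [Field k] [CharP k p] [IsAlgClosed k] (n : ℕ) (H : AlgebraicGeometry.Scheme.{0}) (ι : H ⟶ (Literature.AlgebraicGeometry.Motives.projectiveSpace n k).left), AlgebraicGeometry.IsClosedImmersion ι → AlgebraicGeometry.IsIntegral H → (∀ y : (Literature.AlgebraicGeometry.Motives.projectiveSpace n k).left, ∃ U : (Literature.AlgebraicGeometry.Motives.projectiveSpace n k).left.affineOpens, y ∈ (U : (Literature.AlgebraicGeometry.Motives.projectiveSpace n k).left.Opens) ∧ (ι.ker.ideal U).IsPrincipal) → 5 ≤ n → ∃ 𝔞 : H.IdealSheafData, 𝔞 ≠ ⊥ ∧ ∀ (Z : AlgebraicGeometry.Scheme.{0}) (π : Z ⟶ H), Literature.AlgebraicGeometry.Resolution.IsBlowup π 𝔞 → Literature.AlgebraicGeometry.Resolution.Scheme.IsRegular Z) :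
    Summit.ResolutionOfSingularities.ResolutionOfSingularities.Theses.EquisingularLift.EquisingularLift :=
  equisingularLift_of_blowupModels (blowupModel_ge_three_of_cases (stub_blowupModel_three_of_sigmaMaxElimination hσ)
    (stub_blowupModel_four_of_CP2019General hCP) h5)

end Summit.ResolutionOfSingularities.ResolutionOfSingularities.Cruxes.EquisingularLift.StrataSplit

end
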